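import Literature.Analysis.FluidPDE.SereginSverak2002VertexBlowupLimit
import Literature.Analysis.FluidPDE.LocalTypeIMorreyProofs
import Literature.Analysis.FluidPDE.LocalTypeIScaling
import Literature.Analysis.FluidPDE.ClassicalSuitable
import HarnessLib

/-!
# Route HardyPointSink — `HardyAncientLimit`, step 1: a Hardy-bounded vertex is Type I

Support file for item stmt-NavierStokesRegularity-9138 (`HardyAncientLimit`) of route
`HardyPointSink` (problem `NavierStokesRegularity`).

Setting (viscosity already normalised to `1`): `(u, p)` is a classical solution of the unforced
Navier–Stokes system on `[0, T) × ℝ³` which is Leray–Hopf on `[0, T]`, `xs ∈ ℝ³`, and the local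
Hardy energies near `xs` are bounded up to the final time,
`∫_{B(xs, r₀)} |u(t, x)|² / |x − x₀| dx ≤ K` for all `x₀ ∈ B(xs, r₀)` and `T − r₀² < t < T`.

Content:

* `HardyAncientLimit.cknA_le_of_hardy` — the Hardy bound dominates Caffarelli–Kohn–Nirenberg's
  scaled energy `A(Q(z, r)) = sup_t r⁻¹ ∫_{B(x, r)} |u|²` on every parabolic sub-ball `Q(z, r)` of
  the vertex ball `Q((T, xs), c)` (`c ≤ r₀`, `c² ≤ T`): on `B(x, r)` one has `r⁻¹ ≤ |y − x|⁻¹`.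
* `HardyAncientLimit.typeIBound_vertex_lt_top` — hence, by Albritton–Barker 2019, Lemma 2.6
  (the tree's `albrittonBarker2019_lemma_2_6_holds`, after Seregin 2006) applied to the zoomed
  pair, Albritton–Barker's Type I quantity of the half ball is finite:
  `𝐈(Q((T, xs), c/2)) < ∞`, computed with the gauged (Riesz) pressure
  `q = p − (p(t, 0) − p̃[u(t)](0))` of `SereginSverak2002.isSuitableWeakSolutionInBall_vertex` and
  the classical gradient `∇u` (a weak spatial gradient below the final time).

## References

* D. Albritton, T. Barker, J. Math. Fluid Mech. 21 (2019) = arXiv:1811.00502, Lemma 2.6.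
* G. Seregin, arXiv:math/0607537 = J. Math. Sci. 143 (2007), Lemma 2.1.
* L. Caffarelli, R. Kohn, L. Nirenberg, CPAM 35 (1982), §2.
-/

noncomputable section

open Literature.Analysis.FluidPDE MeasureTheory Set Function Filter Topology Metric TopologicalSpace
open scoped ENNReal NNReal

namespace Summit.NavierStokesRegularity.NavierStokesRegularity.Theorems

namespace HardyAncientLimit

variable {T : ℝ} {u : ℝ → (EuclideanSpace ℝ (Fin 3)) → (EuclideanSpace ℝ (Fin 3))} {p : ℝ → (EuclideanSpace ℝ (Fin 3)) → ℝ}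

/-! ### The Hardy energy dominates the scaled energy `A` -/

/-- On the ball `B(x', r)` the weight `|x − x'|⁻¹` is at least `r⁻¹`, so
`r⁻¹ ∫_{B(x', r)} ‖f‖² ≤ ∫_{B(x', r)} ‖f‖² / |x − x'|` (in `ℝ≥0∞`). [folklore] -/
theorem inv_mul_lintegral_ball_le_lintegral_div (f : (EuclideanSpace ℝ (Fin 3)) → (EuclideanSpace ℝ (Fin 3))) (x' : (EuclideanSpace ℝ (Fin 3))) {r : ℝ} (hr : 0 < r) :
    (ENNReal.ofReal r)⁻¹ * ∫⁻ x in ball x' r, ‖f x‖ₑ ^ 2 ≤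
      ∫⁻ x in ball x' r, ‖f x‖ₑ ^ 2 / ‖x - x'‖ₑ := by
  have hr0 : (ENNReal.ofReal r)⁻¹ ≠ ⊤ := ENNReal.inv_ne_top.2 (by simpa using hr)
  rw [← lintegral_const_mul' _ _ hr0]
  refine setLIntegral_mono' measurableSet_ball fun x hx => ?_
  rw [div_eq_mul_inv, mul_comm]
  refine mul_le_mul' le_rfl ?_
  rw [ENNReal.inv_le_inv, ← ofReal_norm, ← dist_eq_norm]
  exact ENNReal.ofReal_le_ofReal (le_of_lt (mem_ball.1 hx))

/-- A parabolic sub-ball `Q(z, r) ⊆ Q(z₁, c)` of positive radius has its spatial ball inside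
`B(z₁.2, c)` and its times inside `(z₁.1 − c², z₁.1)`. [folklore] -/
theorem ball_subset_and_Ioo_subset_of_parabolicCylinder_subset {r c : ℝ} (hr : 0 < r)
    {z z₁ : ℝ × (EuclideanSpace ℝ (Fin 3))} (hz : parabolicCylinder r z ⊆ parabolicCylinder c z₁) :
    ball z.2 r ⊆ ball z₁.2 c ∧ Ioo (z.1 - r ^ 2) z.1 ⊆ Ioo (z₁.1 - c ^ 2) z₁.1 := by
  rw [parabolicCylinder, parabolicCylinder, prod_subset_prod_iff] at hz
  rcases hz with ⟨h1, h2⟩ | h | h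
  · exact ⟨h2, h1⟩
  · exact absurd h (nonempty_Ioo.2 (by nlinarith)).ne_empty
  · exact absurd h (nonempty_ball.2 hr).ne_empty

/-- **The Hardy bound dominates `A` on every sub-ball of the vertex ball.** If
`∫_{B(xs, r₀)} |u(t)|²/|x − x₀| ≤ K` for all `x₀ ∈ B(xs, r₀)` and all `t ∈ [0, T)` with
`T − r₀² < t`, then for `0 < c ≤ r₀` with `c² ≤ T` and every parabolic ball
`Q(z, r) ⊆ Q((T, xs), c)`, `r > 0`, the scaled energy satisfies `A(Q(z, r); u) ≤ K`
(genuine supremum in time, `cknA`). [folklore] -/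
theorem cknA_le_of_hardy {xs : (EuclideanSpace ℝ (Fin 3))} {r₀ c : ℝ} {K : ℝ≥0} (hc : 0 < c) (hcr : c ≤ r₀)
    (hcT : c ^ 2 ≤ T)
    (hH : ∀ x₀ ∈ ball xs r₀, ∀ t ∈ Ico 0 T, T - r₀ ^ 2 < t →
      ∫⁻ x in ball xs r₀, ‖u t x‖ₑ ^ 2 / ‖x - x₀‖ₑ ≤ K)
    {r : ℝ} (hr : 0 < r) {z : ℝ × (EuclideanSpace ℝ (Fin 3))}
    (hz : parabolicCylinder r z ⊆ parabolicCylinder c ((T, xs) : ℝ × (EuclideanSpace ℝ (Fin 3)))) :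
    cknA r z u ≤ K := by
  obtain ⟨hball, hIoo⟩ := ball_subset_and_Ioo_subset_of_parabolicCylinder_subset hr hz
  have hball₀ : ball z.2 r ⊆ ball xs r₀ := hball.trans (ball_subset_ball hcr)
  have hz2 : z.2 ∈ ball xs r₀ := hball₀ (mem_ball_self hr)
  have hcr2 : c ^ 2 ≤ r₀ ^ 2 := pow_le_pow_left₀ hc.le hcr 2
  unfold cknA
  refine iSup₂_le fun t ht => ?_
  have ht' : t ∈ Ioo (T - c ^ 2) T := hIoo ht
  have htI : t ∈ Ico 0 T := ⟨by linarith [ht'.1], ht'.2⟩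
  have htr : T - r₀ ^ 2 < t := by linarith [ht'.1]
  calc (ENNReal.ofReal r)⁻¹ * ∫⁻ x in ball z.2 r, ‖u t x‖ₑ ^ 2
      ≤ ∫⁻ x in ball z.2 r, ‖u t x‖ₑ ^ 2 / ‖x - z.2‖ₑ :=
        inv_mul_lintegral_ball_le_lintegral_div (u t) z.2 hr
    _ ≤ ∫⁻ x in ball xs r₀, ‖u t x‖ₑ ^ 2 / ‖x - z.2‖ₑ := lintegral_mono_set hball₀
    _ ≤ K := hH z.2 hz2 t htI htr

/-- The essential-supremum form `A = cknAEss` of Albritton–Barker is bounded likewise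
(`esssup ≤ sup`). [folklore] -/
theorem cknAEss_le_of_hardy {xs : (EuclideanSpace ℝ (Fin 3))} {r₀ c : ℝ} {K : ℝ≥0} (hc : 0 < c) (hcr : c ≤ r₀)
    (hcT : c ^ 2 ≤ T)
    (hH : ∀ x₀ ∈ ball xs r₀, ∀ t ∈ Ico 0 T, T - r₀ ^ 2 < t →
      ∫⁻ x in ball xs r₀, ‖u t x‖ₑ ^ 2 / ‖x - x₀‖ₑ ≤ K)
    {r : ℝ} (hr : 0 < r) {z : ℝ × (EuclideanSpace ℝ (Fin 3))}
    (hz : parabolicCylinder r z ⊆ parabolicCylinder c ((T, xs) : ℝ × (EuclideanSpace ℝ (Fin 3)))) :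
    cknAEss r z u ≤ K :=
  cknAEss_le_cknA.trans (cknA_le_of_hardy hc hcr hcT hH hr hz)

/-! ### The classical gradient below the final time -/

/-- The backward ball `Q((T, xs), c)`, `c² ≤ T`, lies in the open slab `(0, T) × ℝ³` where the
classical solution is smooth; there the classical derivative `∇u` is a weak spatial gradient
(Caffarelli–Kohn–Nirenberg 1982, (2.1)). [folklore] -/
theorem hasWeakSpatialGradientOn_fderiv_vertex (hsol : IsClassicalNSSolutionOn (Ico 0 T) 1 0 u p)
    (xs : (EuclideanSpace ℝ (Fin 3))) {c : ℝ} (hcT : c ^ 2 ≤ T) :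
    HasWeakSpatialGradientOn (parabolicCylinderOpens c ((T, xs) : ℝ × (EuclideanSpace ℝ (Fin 3)))) u
      fun t x => fderiv ℝ (u t) x := by
  have hQ : ((parabolicCylinderOpens c ((T, xs) : ℝ × (EuclideanSpace ℝ (Fin 3))) : Opens (ℝ × (EuclideanSpace ℝ (Fin 3)))) : Set (ℝ × (EuclideanSpace ℝ (Fin 3)))) ⊆
      Ioo 0 T ×ˢ (univ : Set (EuclideanSpace ℝ (Fin 3))) := by
    rw [coe_parabolicCylinderOpens]
    exact SereginSverak2002.parabolicCylinder_vertex_subset_slab hcT xs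
  have hu : ContDiffOn ℝ 1 (uncurry u) (Ioo 0 T ×ˢ (univ : Set (EuclideanSpace ℝ (Fin 3)))) :=
    (hsol.smooth_velocity.mono Ioo_subset_Ico_self).of_le (by exact_mod_cast le_top)
  exact hasWeakSpatialGradientOn_of_contDiffOn isOpen_Ioo hQ hu

/-! ### Type I at the vertex (Albritton–Barker 2019, Lemma 2.6) -/

/-- **A Hardy-bounded vertex is a Type I point in Albritton–Barker's sense.** Let `(u, p)` be a
classical solution of the unforced Navier–Stokes system (`ν = 1`) on `[0, T) × ℝ³`, Leray–Hopf on
`[0, T]`, with the local Hardy bound near `xs` up to the final time. For `0 < c ≤ r₀` with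
`c² ≤ T`, Albritton–Barker's Type I quantity of the half ball `Q((T, xs), c/2)` — computed with the
gauged pressure `q = p − (p(t, 0) − p̃[u(t)](0))` and the classical gradient `∇u` — is finite:
`𝐈(Q((T, xs), c/2)) < ∞`. Proof: `(u, q)` is a suitable weak solution in the ball
(`SereginSverak2002.isSuitableWeakSolutionInBall_vertex`); zoom it to the unit ball; the Hardy
bound dominates `A` on every sub-ball (`cknAEss_le_of_hardy`, scale invariance `cknAEss_nsZoom`);
Albritton–Barker 2019, Lemma 2.6 (`albrittonBarker2019_lemma_2_6_holds`) bounds `𝐈` of the half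
ball; zoom back (`typeIBound_nsZoom`). -/
theorem typeIBound_vertex_lt_top (hT : 0 < T) (hsol : IsClassicalNSSolutionOn (Ico 0 T) 1 0 u p)
    (hLH : IsLerayHopfOn T 1 0 (u 0) u) {xs : (EuclideanSpace ℝ (Fin 3))} {r₀ : ℝ} {K : ℝ≥0}
    (hH : ∀ x₀ ∈ ball xs r₀, ∀ t ∈ Ico 0 T, T - r₀ ^ 2 < t →
      ∫⁻ x in ball xs r₀, ‖u t x‖ₑ ^ 2 / ‖x - x₀‖ₑ ≤ K)
    {c : ℝ} (hc : 0 < c) (hcr : c ≤ r₀) (hcT : c ^ 2 ≤ T) :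
    typeIBound (parabolicCylinder (c / 2) ((T, xs) : ℝ × (EuclideanSpace ℝ (Fin 3)))) u
        (fun t x => p t x - (p t 0 - normalisedPressure (u t) 0))
        (fun t x => fderiv ℝ (u t) x) < ∞ := by
  set z₁ : ℝ × (EuclideanSpace ℝ (Fin 3)) := (T, xs) with hz₁
  set q : ℝ → (EuclideanSpace ℝ (Fin 3)) → ℝ := fun t x => p t x - (p t 0 - normalisedPressure (u t) 0) with hq
  set G : ℝ → (EuclideanSpace ℝ (Fin 3)) → (EuclideanSpace ℝ (Fin 3)) →L[ℝ] (EuclideanSpace ℝ (Fin 3)) := fun t x => fderiv ℝ (u t) x with hG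
  have hc2 : 0 < c ^ 2 := pow_pos hc 2
  -- the suitable pair in the vertex ball and its zoom to the unit ball
  have hsw : IsSuitableWeakSolutionInBall c z₁ u q :=
    SereginSverak2002.isSuitableWeakSolutionInBall_vertex hT hsol hLH xs hcT
  have hzoom := hsw.zoom hc
  -- the zoomed classical gradient is a weak spatial gradient on the unit ball
  have hGw : HasWeakSpatialGradientOn (parabolicCylinderOpens c z₁) u G :=
    hasWeakSpatialGradientOn_fderiv_vertex hsol xs hcT
  have hGz : HasWeakSpatialGradientOn (parabolicCylinderOpens 1 (0 : ℝ × (EuclideanSpace ℝ (Fin 3))))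
      (c • stPull (c ^ 2) c z₁.1 z₁.2 u) ((c ^ 2) • stPull (c ^ 2) c z₁.1 z₁.2 G) := by
    have h := hGw.stRescale c hc2 hc z₁.1 z₁.2
    rw [zoom_stPreimage_parabolicCylinderOpens hc z₁, ← sq] at h
    exact h
  -- surjectivity of the zoom, to transport inclusions of balls
  have hsurj : Function.Surjective (stAffine (c ^ 2) c z₁.1 z₁.2) :=
    (stAffineHomeomorph (pow_ne_zero 2 hc.ne') hc.ne' z₁.1 z₁.2).surjective
  -- `A` of the zoomed velocity is bounded by `K` on every sub-ball of the unit ball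
  have hA : (⨆ (r : ℝ) (_ : 0 < r) (z' : ℝ × (EuclideanSpace ℝ (Fin 3)))
      (_ : parabolicCylinder r z' ⊆ parabolicCylinder 1 (0 : ℝ × (EuclideanSpace ℝ (Fin 3)))),
        cknAEss r z' (c • stPull (c ^ 2) c z₁.1 z₁.2 u)) < ∞ := by
    refine lt_of_le_of_lt ?_ (ENNReal.coe_lt_top (r := K))
    refine iSup_le fun r => iSup_le fun hr => iSup_le fun z' => iSup_le fun hz' => ?_
    rw [cknAEss_nsZoom hc hr]
    refine cknAEss_le_of_hardy hc hcr hcT hH (mul_pos hc hr) ?_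
    rw [← hsurj.preimage_subset_preimage_iff,
      LocalTypeIScaling.stAffine_preimage_parabolicCylinder hc z₁.1 z₁.2 r z',
      show parabolicCylinder c ((T, xs) : ℝ × (EuclideanSpace ℝ (Fin 3))) = parabolicCylinder c z₁ from rfl,
      zoom_preimage_parabolicCylinder_self hc z₁]
    exact hz'
  -- Lemma 2.6 on the unit ball, at `R = 1/2`
  have h26 := albrittonBarker2019_lemma_2_6_holds (0 : ℝ × (EuclideanSpace ℝ (Fin 3))) _ _ hzoom _ hGz (Or.inl hA)
    (1 / 2) (by norm_num) (by norm_num)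
  -- zoom back
  rw [← zoom_preimage_parabolicCylinder_half hc z₁, typeIBound_nsZoom hc] at h26
  exact h26

end HardyAncientLimit

end Summit.NavierStokesRegularity.NavierStokesRegularity.Theorems

end
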